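import Mathlib
import Summits.ValiantsHypothesis.ValiantsHypothesis.Theorems.FifoMatchingNNMonotoneHardTests
import Summits.ValiantsHypothesis.ValiantsHypothesis.Theorems.FifoMatchingNNMonotoneHardPadBoundaries
import HarnessLib

/-!
# Crux `NNMonotoneHard` (stmt-ValiantsHypothesis-11617): the boundary tests for the padded word
# (pieces (B)+(C) of `Cruxes/NNMonotoneHard/PROOF-PLAN.md`, instantiated)

For a fixed colouring `σ` of `Fin (L + N + L)` and a colour `x`, let `P_x` be the set of middle
positions `p ≥ 1` that are boundaries INTO `x` (`σ(L+p−1) ≠ x = σ(L+p)`); these are pairwise `≥ 2`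
apart.  For every balanced middle word `v` with prefix sums in `(-m, m)` (`m ≤ L`) whose padded
word's FIFO pairing respects `σ`, the letter pair `(v(p−1), v p)` avoids, at every `p ∈ P_x`, the
pattern of `boundary_test` — a pattern that depends on `v` only through the letters before `p − 1`
(`pattern_eq_of_agree`).  The test lemma `card_filter_avoid_le` then gives

  `card_resp_mul_four_pow_le`: `#{such v} · 4^{#P_x} ≤ 3^{#P_x} · 2^N`.

Honest framing: bookkeeping toward a monotone lower bound for ONE candidate family; VP ≠ VNP is not
moved by anything here.  No definitions, no named facts.
-/

noncomputable section

-- Sub = Summit single-conjunct layout: the duplicated namespace component is mandated by the tree.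
set_option linter.dupNamespace false

namespace Summit.ValiantsHypothesis.ValiantsHypothesis.Theorems.FifoMatching.NNMonotoneHard

open Finset Literature.Computability.AlgebraicComplexity

section PadTests

variable {L N : ℕ}

/-- Two padded words agree below time `L + q` when the middle words agree below `q`. [folklore] -/
theorem padWord_eq_of_agree (v w : Fin N → Bool) {q : ℕ} (hvw : ∀ i : Fin N, i.val < q → v i = w i)
    (i : Fin (L + N + L)) (hi : i.val < L + q) : padWord L N v i = padWord L N w i := by
  unfold padWord
  by_cases h1 : i.val < L
  · rw [if_pos h1, if_pos h1]
  · rw [if_neg h1, if_neg h1]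
    by_cases h2 : i.val - L < N
    · rw [dif_pos h2, dif_pos h2]
      exact hvw _ (by simp only; omega)
    · rw [dif_neg h2, dif_neg h2]

/-- The opener / closer sets of two padded words below a time where they agree. [folklore] -/
theorem filter_lt_eq_of_agree (v w : Fin N → Bool) {q : ℕ} (hvw : ∀ i : Fin N, i.val < q → v i = w i)
    (t : Fin (L + N + L)) (ht : t.val ≤ L + q) :
    ((openerSet (padWord L N v)).filter fun i => i < t)
        = ((openerSet (padWord L N w)).filter fun i => i < t) ∧
      ((closerSet (padWord L N v)).filter fun i => i < t)
        = ((closerSet (padWord L N w)).filter fun i => i < t) := by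
  constructor <;>
  · ext i
    simp only [mem_filter, mem_openerSet, mem_closerSet, Fin.lt_def]
    constructor <;> rintro ⟨h1, h2⟩ <;> refine ⟨?_, h2⟩
    · rwa [← padWord_eq_of_agree v w hvw i (by omega)]
    · rwa [padWord_eq_of_agree v w hvw i (by omega)]

/-- The `k`-th opener is determined by the openers below any later time. [folklore] -/
theorem orderEmbOfFin_eq_of_agree (v w : Fin N → Bool) {q : ℕ}
    (hvw : ∀ i : Fin N, i.val < q → v i = w i) (t : Fin (L + N + L)) (ht : t.val ≤ L + q)
    (k : ℕ) (hkv : k < ((openerSet (padWord L N v)).filter fun i => i < t).card)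
    (hkw : k < ((openerSet (padWord L N w)).filter fun i => i < t).card) :
    (openerSet (padWord L N v)).orderEmbOfFin rfl ⟨k, lt_of_lt_of_le hkv (card_filter_le _ _)⟩
      = (openerSet (padWord L N w)).orderEmbOfFin rfl ⟨k, lt_of_lt_of_le hkw (card_filter_le _ _)⟩ := by
  have e1 := orderEmbOfFin_eq_of_filter (openerSet (padWord L N v)) rfl t
    ⟨k, lt_of_lt_of_le hkv (card_filter_le _ _)⟩ hkv
  have e2 := orderEmbOfFin_eq_of_filter (openerSet (padWord L N w)) rfl t
    ⟨k, lt_of_lt_of_le hkw (card_filter_le _ _)⟩ hkw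
  rw [e1, e2]
  have hs := (filter_lt_eq_of_agree v w hvw t ht).1
  have key : ∀ (s₁ s₂ : Finset (Fin (L + N + L))) (hs : s₁ = s₂) (h₁ : k < s₁.card) (h₂ : k < s₂.card),
      s₁.orderEmbOfFin rfl ⟨k, h₁⟩ = s₂.orderEmbOfFin rfl ⟨k, h₂⟩ := by
    intro s₁ s₂ hs; subst hs; intro h₁ h₂; rfl
  exact key _ _ hs _ _

/-- **Tests for the padded word.**  Fix `σ`, `x`, and let `P_x` be the middle boundaries into `x`.
The number of balanced thick middle words (`prefix sums in (-m, m)`, `m ≤ L`) whose padded word's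
FIFO pairing respects `σ` satisfies `# · 4^{#P_x} ≤ 3^{#P_x} · 2^N`. [folklore] -/
theorem card_resp_mul_four_pow_le {m : ℕ} (hmL : m ≤ L)
    (σ : Fin (L + N + L) → Bool) (x : Bool) :
    ((univ : Finset (Fin N → Bool)).filter fun v =>
        ∃ hb : 2 * ((univ : Finset (Fin N)).filter fun p => v p = true).card = N,
          (∀ j, j ≤ N →
            ((univ : Finset (Fin N)).filter fun p => p.val < j ∧ v p = false).card
              < ((univ : Finset (Fin N)).filter fun p => p.val < j ∧ v p = true).card + m ∧
            ((univ : Finset (Fin N)).filter fun p => p.val < j ∧ v p = true).card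
              < ((univ : Finset (Fin N)).filter fun p => p.val < j ∧ v p = false).card + m) ∧
          ∀ k : Fin (openerSet (padWord L N v)).card,
            σ ((openerSet (padWord L N v)).orderEmbOfFin rfl k)
              = σ ((closerSet (padWord L N v)).orderEmbOfFin (balanced_padWord v hb) k)).card
      * 4 ^ ((univ : Finset (Fin N)).filter fun p => ∃ hp : 1 ≤ p.val,
          σ ⟨L + p.val - 1, by omega⟩ ≠ x ∧ σ ⟨L + p.val, by omega⟩ = x).card
    ≤ 3 ^ ((univ : Finset (Fin N)).filter fun p => ∃ hp : 1 ≤ p.val,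
          σ ⟨L + p.val - 1, by omega⟩ ≠ x ∧ σ ⟨L + p.val, by omega⟩ = x).card * 2 ^ N := by
  classical
  -- the pattern read off the opener / closer sets below time `L + p - 1`
  let Pat : Finset (Fin (L + N + L)) → Finset (Fin (L + N + L)) → Bool → Bool × Bool :=
    fun A B c => if hq : B.card < A.card then
      (if σ (A.orderEmbOfFin rfl ⟨B.card, hq⟩) = c then (false, true) else (true, false))
      else (true, true)
  let π : Fin N → (Fin N → Bool) → Bool × Bool := fun p v =>
    Pat ((openerSet (padWord L N v)).filter fun i =>
          i < (⟨L + p.val - 1, by omega⟩ : Fin (L + N + L)))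
        ((closerSet (padWord L N v)).filter fun i =>
          i < (⟨L + p.val - 1, by omega⟩ : Fin (L + N + L)))
        (σ ⟨L + p.val, by omega⟩)
  refine card_filter_avoid_le _ ?_ ?_ π ?_ _ ?_
  · -- positions are `≥ 1`
    intro p hp
    obtain ⟨hp1, -⟩ := (mem_filter.1 hp).2
    exact hp1
  · -- same-direction boundaries are `≥ 2` apart
    intro p hp q hq hpq
    obtain ⟨hp1, hp2, hp3⟩ := (mem_filter.1 hp).2
    obtain ⟨hq1, hq2, hq3⟩ := (mem_filter.1 hq).2
    by_contra hlt
    have hqp : q.val = p.val + 1 := by rw [Fin.lt_def] at hpq; omega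
    apply hq2
    convert hp3 using 2
    apply Fin.ext
    simp only
    omega
  · -- the pattern depends only on the strict past
    intro p hp v w hvw
    obtain ⟨hp1, -⟩ := (mem_filter.1 hp).2
    have hvw' : ∀ i : Fin N, i.val < p.val - 1 → v i = w i := fun i hi => hvw i (by omega)
    have ht : (⟨L + p.val - 1, by omega⟩ : Fin (L + N + L)).val ≤ L + (p.val - 1) := by
      simp only; omega
    obtain ⟨hO, hC⟩ := filter_lt_eq_of_agree v w hvw' _ ht
    show Pat _ _ _ = Pat _ _ _
    rw [hO, hC]
  · -- respecting words avoid the patterns (`boundary_test`)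
    intro v hv p hp
    obtain ⟨hb, hband, hresp⟩ := (mem_filter.1 hv).2
    obtain ⟨hp1, hp2, hp3⟩ := (mem_filter.1 hp).2
    have hq0 := queue_nonempty_padWord (L := L) v (fun j hj => (hband j hj).1) hmL
      (t := L + p.val - 1) (by omega) (by omega)
    have hq : ((closerSet (padWord L N v)).filter fun i =>
          i < (⟨L + p.val - 1, by omega⟩ : Fin (L + N + L))).card
        < ((openerSet (padWord L N v)).filter fun i =>
          i < (⟨L + p.val - 1, by omega⟩ : Fin (L + N + L))).card := by
      rw [filter_lt_fin_eq, filter_lt_fin_eq]; exact hq0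
    have key := boundary_test σ hresp (s' := ⟨L + p.val - 1, by omega⟩) (s := ⟨L + p.val, by omega⟩)
      (by simp only; omega) (by rw [hp3]; exact hp2)
      ⟨((closerSet (padWord L N v)).filter fun i =>
        i < (⟨L + p.val - 1, by omega⟩ : Fin (L + N + L))).card,
        lt_of_lt_of_le hq (card_filter_le _ _)⟩ rfl
    have h1 : padWord L N v ⟨L + p.val - 1, by omega⟩
        = v ⟨p.val - 1, lt_of_le_of_lt (Nat.sub_le _ _) p.isLt⟩ := by
      have := padWord_apply_mid (L := L) v ⟨p.val - 1, lt_of_le_of_lt (Nat.sub_le _ _) p.isLt⟩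
      convert this using 2; apply Fin.ext; simp only; omega
    have h2 : padWord L N v ⟨L + p.val, by omega⟩ = v p := padWord_apply_mid (L := L) v p
    rw [h1, h2, orderEmbOfFin_eq_of_filter _ rfl _ _ hq] at key
    show (_, _) ≠ Pat _ _ _
    simp only [Pat, dif_pos hq]
    exact key

end PadTests

end Summit.ValiantsHypothesis.ValiantsHypothesis.Theorems.FifoMatching.NNMonotoneHard
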